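import Literature.MathematicalPhysics.QuantumManyBody.StateRelaxationDuality
import Literature.MathematicalPhysics.QuantumLattice.SectorGroundProjContinuity
import HarnessLib

/-!
# The symmetric ground state of a sector is a feasible point of the bootstrap

Family `hubbard` (trunk T-QLATTICE). The primal half of the many-body bootstrap (X. Han,
arXiv:2006.06002 (2020), §2, after eq. (3): "the functional `F[O] = tr(ρ₀ O)` is always in `𝒜` for
a ground state `ρ₀` of `H` that also commutes with all the charges `C_α` and `U_α`") for a
finite-dimensional Hamiltonian restricted to a symmetry sector: for a Hermitian matrix `A` and an
`A`-invariant subspace `K ≠ ⊥` (a particle-number / `S^z` sector) let `e = minEnergyOn A K`,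
`E = K ⊓ ker (A − e)` the sector ground multiplet (`Matrix.sectorGroundSpace`), `P` the orthogonal
projection onto it (`Matrix.sectorGroundProj`) and `ω(O) = tr (P O) / tr P` the TRACIAL SECTOR
GROUND STATE (`Matrix.projState P`). Then

* `ω` is positive and normalised (`projState_nonneg`, `projState_one`), so its moment matrices are
  positive semidefinite (`StateRelaxation.posSemidef_stateMoments`);
* `A P = P A = e P` (`mul_sectorGroundProj`, `sectorGroundProj_mul`), hence `ω(A X) = e ω(X) = ω(X A)`
  and `ω([A, X]) = 0`, `ω(A) = e` (`projState_mul_left/right`, `projState_self`);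
* every `U` commuting with `A` and preserving `K` in both directions commutes with `P`
  (`sectorGroundProj_commute`), so for `Uᴴ U = 1`: `ω(U O Uᴴ) = ω(O)` (`projState_conj`) —
  translation / point-group / spin-rotation invariance;
* operators acting as a scalar `q` on `K` (`N̂ = N`, `S^z = M`) satisfy `(Q − q) P = 0 = P (Q − q)`
  for Hermitian `Q` (`sub_smul_mul_sectorGroundProj`, `sectorGroundProj_mul_sub_smul`), so the
  sector ideal `Y (Q − q) + (Q − q) Y'` has zero expectation.

Consequently a dual certificate using ALL of Han's constraints — positivity, `⟨[H,O]⟩ = 0`,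
symmetry invariance and the sector ideal — bounds the sector energy:
`minEnergyOn_ge_of_symmetric_certificate`. Everything is PROVED; no named fact is introduced.

## References
* X. Han, *Quantum many-body bootstrap*, arXiv:2006.06002 (2020), §2. [cite: Han2020Bootstrap, §2]
* H. Tasaki, *Physics and Mathematics of Quantum Many-Body Systems* (2020), §2.1–2.2, App. A.2
  (ground states in a sector, symmetry of ground-state expectations). [cite: Tasaki2020, §2.2]
-/

noncomputable section

open Literature.MathematicalPhysics.QuantumLattice
open Literature.MathematicalPhysics.QuantumManyBody.StateRelaxation
open scoped ComplexOrder BigOperators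

namespace Matrix

variable {n : Type*} [Fintype n] [DecidableEq n]

/-! ### The tracial state of a projection -/

/-- (Dot-notation extension of Mathlib's `Matrix`.) The tracial state `O ↦ tr (P O) / tr P` of a
matrix `P` (meant for a nonzero orthogonal projection: the uniform mixture over its range).
Junk value `0` when `tr P = 0`. Tasaki (2020) §2.1. [cite: Tasaki2020, §2.1] -/
def projState (P : Matrix n n ℂ) : Matrix n n ℂ →ₗ[ℂ] ℂ :=
  (P.trace)⁻¹ • (Matrix.traceLinearMap n ℂ ℂ ∘ₗ LinearMap.mulLeft ℂ P)

/-- Unfolding lemma for `projState`. [folklore] -/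
theorem projState_apply (P O : Matrix n n ℂ) : P.projState O = (P.trace)⁻¹ * (P * O).trace := rfl

/-- The tree's tracial ground state is the tracial state of the ground projection. [folklore] -/
theorem groundStateFunctional_eq_projState (A : Matrix n n ℂ) :
    A.groundStateFunctional = A.groundProj.projState := rfl

omit [DecidableEq n] in
/-- A Hermitian idempotent is `Pᴴ P`, hence positive semidefinite (cf.
`Literature.MathematicalPhysics.QuantumLattice.posSemidef_of_isHermitian_of_mul_self`). [folklore] -/
theorem posSemidef_of_proj {P : Matrix n n ℂ} (hP : P.IsHermitian) (hP2 : P * P = P) :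
    (Pᴴ * P).PosSemidef ∧ Pᴴ * P = P :=
  ⟨posSemidef_conjTranspose_mul_self _, by rw [hP.eq, hP2]⟩

omit [DecidableEq n] in
/-- A nonzero Hermitian idempotent has positive trace. [folklore] -/
theorem trace_pos_of_proj {P : Matrix n n ℂ} (hP : P.IsHermitian) (hP2 : P * P = P) (hP0 : P ≠ 0) :
    0 < P.trace := by
  obtain ⟨hpsd, hPP⟩ := posSemidef_of_proj hP hP2
  rw [hPP] at hpsd
  exact lt_of_le_of_ne hpsd.trace_nonneg fun h => hP0 (hpsd.trace_eq_zero_iff.1 h.symm)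

/-- `ω_P(1) = 1` for a nonzero Hermitian idempotent `P`. [folklore] -/
theorem projState_one {P : Matrix n n ℂ} (hP : P.IsHermitian) (hP2 : P * P = P) (hP0 : P ≠ 0) :
    P.projState 1 = 1 := by
  rw [projState_apply, mul_one, inv_mul_cancel₀ (trace_pos_of_proj hP hP2 hP0).ne']

/-- Positivity: `0 ≤ ω_P(Oᴴ O)` for a Hermitian idempotent `P`. [folklore] -/
theorem projState_nonneg {P : Matrix n n ℂ} (hP : P.IsHermitian) (hP2 : P * P = P)
    (O : Matrix n n ℂ) : 0 ≤ P.projState (Oᴴ * O) := by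
  obtain ⟨hpsd, hPP⟩ := posSemidef_of_proj hP hP2
  rw [hPP] at hpsd
  rw [projState_apply]
  refine mul_nonneg ?_ ?_
  · have hZ : 0 ≤ P.trace := hpsd.trace_nonneg
    obtain ⟨hre, him⟩ := Complex.nonneg_iff.mp hZ
    rw [Complex.nonneg_iff]
    simp [Complex.inv_re, Complex.inv_im, ← him, div_nonneg, hre, Complex.normSq_nonneg]
  · rw [← mul_assoc, trace_mul_cycle]
    exact (hpsd.mul_mul_conjTranspose_same O).trace_nonneg

/-- If `A P = E P` then `ω_P(O A) = E ω_P(O)` (cyclicity of the trace). [folklore] -/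
theorem projState_mul_right {P A : Matrix n n ℂ} {E : ℂ} (hAP : A * P = E • P) (O : Matrix n n ℂ) :
    P.projState (O * A) = E * P.projState O := by
  rw [projState_apply, projState_apply, ← mul_assoc, trace_mul_cycle, hAP, smul_mul_assoc,
    trace_smul, smul_eq_mul]
  ring

/-- If `P A = E P` then `ω_P(A O) = E ω_P(O)`. [folklore] -/
theorem projState_mul_left {P A : Matrix n n ℂ} {E : ℂ} (hPA : P * A = E • P) (O : Matrix n n ℂ) :
    P.projState (A * O) = E * P.projState O := by
  rw [projState_apply, projState_apply, ← mul_assoc, hPA, smul_mul_assoc, trace_smul, smul_eq_mul]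
  ring

/-- Energy eigen-projections kill commutators: `A P = E P = P A ⇒ ω_P(A X − X A) = 0`.
[cite: Han2020Bootstrap, §2] -/
theorem projState_commutator {P A : Matrix n n ℂ} {E : ℂ} (hAP : A * P = E • P)
    (hPA : P * A = E • P) (X : Matrix n n ℂ) : P.projState (A * X - X * A) = 0 := by
  rw [map_sub, projState_mul_left hPA, projState_mul_right hAP, sub_self]

/-- `ω_P(A) = E` for a nonzero Hermitian idempotent `P` with `P A = E P`. [folklore] -/
theorem projState_self {P A : Matrix n n ℂ} (hP : P.IsHermitian) (hP2 : P * P = P) (hP0 : P ≠ 0)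
    {E : ℂ} (hPA : P * A = E • P) : P.projState A = E := by
  have h := projState_mul_left hPA (1 : Matrix n n ℂ)
  rwa [mul_one, projState_one hP hP2 hP0, mul_one] at h

/-- Symmetry: if `P U = U P` and `Uᴴ U = 1` then `ω_P(U O Uᴴ) = ω_P(O)`. Tasaki (2020) §2.1.
[cite: Tasaki2020, §2.1] -/
theorem projState_conj {P U : Matrix n n ℂ} (hPU : P * U = U * P) (hUU : Uᴴ * U = 1)
    (O : Matrix n n ℂ) : P.projState (U * O * Uᴴ) = P.projState O := by
  rw [projState_apply, projState_apply]
  congr 1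
  calc (P * (U * O * Uᴴ)).trace = (Uᴴ * (P * U) * O).trace := by
        rw [← mul_assoc, ← mul_assoc, trace_mul_cycle, ← mul_assoc]
    _ = (P * O).trace := by rw [hPU, ← mul_assoc, hUU, one_mul]

/-- Sector ideal, right form: `Q P = 0 ⇒ ω_P(Y Q) = 0`. [folklore] -/
theorem projState_mul_of_mul_eq_zero {P Q : Matrix n n ℂ} (hQP : Q * P = 0) (Y : Matrix n n ℂ) :
    P.projState (Y * Q) = 0 := by
  rw [projState_apply, ← mul_assoc, trace_mul_cycle, hQP, zero_mul, trace_zero, mul_zero]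

/-- Sector ideal, left form: `P Q = 0 ⇒ ω_P(Q Y) = 0`. [folklore] -/
theorem projState_mul_of_mul_eq_zero' {P Q : Matrix n n ℂ} (hPQ : P * Q = 0) (Y : Matrix n n ℂ) :
    P.projState (Q * Y) = 0 := by
  rw [projState_apply, ← mul_assoc, hPQ, zero_mul, trace_zero, mul_zero]

/-! ### The sector ground multiplet and its projection -/

/-- (Dot-notation extension of Mathlib's `Matrix`.) The sector ground multiplet
`K ⊓ ker (A − e)`, `e = minEnergyOn A K`, of `A` in the sector `K`. Tasaki (2020) §2.2.
[cite: Tasaki2020, §2.2] -/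
def sectorGroundSpace (A : Matrix n n ℂ) (K : Submodule ℂ (n → ℂ)) : Submodule ℂ (n → ℂ) :=
  K ⊓ Module.End.eigenspace (Matrix.toLin' A) ((A.minEnergyOn K : ℝ) : ℂ)

/-- Membership in the sector ground multiplet: `v ∈ K` and `A v = e v`. [folklore] -/
theorem mem_sectorGroundSpace_iff (A : Matrix n n ℂ) (K : Submodule ℂ (n → ℂ)) (v : n → ℂ) :
    v ∈ A.sectorGroundSpace K ↔ v ∈ K ∧ A *ᵥ v = ((A.minEnergyOn K : ℝ) : ℂ) • v :=
  mem_inf_eigenspace_toLin'_iff A K _ v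

/-- (Dot-notation extension of Mathlib's `Matrix`.) The orthogonal projection onto the sector ground
multiplet, as a matrix (`projMatrix` of its transport to `EuclideanSpace ℂ n`). Tasaki (2020)
App. A.2. [cite: Tasaki2020, App. A.2] -/
def sectorGroundProj (A : Matrix n n ℂ) (K : Submodule ℂ (n → ℂ)) : Matrix n n ℂ :=
  projMatrix ((A.sectorGroundSpace K).map
    ((WithLp.linearEquiv 2 ℂ (n → ℂ)).symm : (n → ℂ) →ₗ[ℂ] EuclideanSpace ℂ n))

/-- The sector ground projection is Hermitian. [folklore] -/
theorem sectorGroundProj_isHermitian (A : Matrix n n ℂ) (K : Submodule ℂ (n → ℂ)) :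
    (A.sectorGroundProj K).IsHermitian :=
  projMatrix_isHermitian _

/-- The sector ground projection is idempotent. [folklore] -/
theorem sectorGroundProj_mul_self (A : Matrix n n ℂ) (K : Submodule ℂ (n → ℂ)) :
    A.sectorGroundProj K * A.sectorGroundProj K = A.sectorGroundProj K :=
  projMatrix_mul_self _

/-- `P w` lies in the sector ground multiplet. [folklore] -/
theorem sectorGroundProj_mulVec_mem (A : Matrix n n ℂ) (K : Submodule ℂ (n → ℂ)) (w : n → ℂ) :
    A.sectorGroundProj K *ᵥ w ∈ A.sectorGroundSpace K :=
  projMatrix_map_mulVec_mem _ w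

/-- `P v = v` on the sector ground multiplet. [folklore] -/
theorem sectorGroundProj_mulVec_of_mem (A : Matrix n n ℂ) (K : Submodule ℂ (n → ℂ)) {v : n → ℂ}
    (hv : v ∈ A.sectorGroundSpace K) : A.sectorGroundProj K *ᵥ v = v :=
  projMatrix_map_mulVec_of_mem _ hv

/-- `A P = e P`: the columns of `P` are sector ground eigenvectors. Tasaki (2020) §2.2.
[cite: Tasaki2020, §2.2] -/
theorem mul_sectorGroundProj (A : Matrix n n ℂ) (K : Submodule ℂ (n → ℂ)) :
    A * A.sectorGroundProj K = ((A.minEnergyOn K : ℝ) : ℂ) • A.sectorGroundProj K := by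
  rw [ext_iff_mulVec]
  intro w
  rw [← mulVec_mulVec, smul_mulVec]
  exact ((mem_sectorGroundSpace_iff A K _).1 (sectorGroundProj_mulVec_mem A K w)).2

/-- `P A = e P` for Hermitian `A` (adjoint of `mul_sectorGroundProj`). [folklore] -/
theorem sectorGroundProj_mul {A : Matrix n n ℂ} (hA : A.IsHermitian) (K : Submodule ℂ (n → ℂ)) :
    A.sectorGroundProj K * A = ((A.minEnergyOn K : ℝ) : ℂ) • A.sectorGroundProj K := by
  have h := congrArg conjTranspose (mul_sectorGroundProj A K)
  rw [conjTranspose_mul, conjTranspose_smul, (sectorGroundProj_isHermitian A K).eq, hA.eq] at h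
  rw [h]
  simp

/-- The range of `P` lies in the sector: `P w ∈ K`. [folklore] -/
theorem sectorGroundProj_mulVec_mem_sector (A : Matrix n n ℂ) (K : Submodule ℂ (n → ℂ))
    (w : n → ℂ) : A.sectorGroundProj K *ᵥ w ∈ K :=
  ((mem_sectorGroundSpace_iff A K _).1 (sectorGroundProj_mulVec_mem A K w)).1

/-- The sector ground projection is nonzero when the sector is `A`-invariant and nonzero
(a sector ground eigenvector exists, `exists_unit_eigen_minEnergyOn`). [folklore] -/
theorem sectorGroundProj_ne_zero {A : Matrix n n ℂ} (hA : A.IsHermitian) (K : Submodule ℂ (n → ℂ))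
    (hKA : ∀ v ∈ K, A *ᵥ v ∈ K) (hK : K ≠ ⊥) : A.sectorGroundProj K ≠ 0 := by
  intro h0
  apply inf_eigenspace_minEnergyOn_ne_bot hA K hKA hK
  rw [Submodule.eq_bot_iff]
  intro v hv
  have h := sectorGroundProj_mulVec_of_mem A K (v := v) hv
  rw [h0, zero_mulVec] at h
  exact h.symm

/-- An operator acting as the scalar `q` on the sector satisfies `Q P = q P`. [folklore] -/
theorem mul_sectorGroundProj_of_scalar_on (A : Matrix n n ℂ) (K : Submodule ℂ (n → ℂ))
    {Q : Matrix n n ℂ} {q : ℂ} (hQ : ∀ v ∈ K, Q *ᵥ v = q • v) :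
    Q * A.sectorGroundProj K = q • A.sectorGroundProj K := by
  rw [ext_iff_mulVec]
  intro w
  rw [← mulVec_mulVec, smul_mulVec]
  exact hQ _ (sectorGroundProj_mulVec_mem_sector A K w)

/-- Sector ideal, right form: `(Q − q·1) P = 0` if `Q = q` on the sector. [folklore] -/
theorem sub_smul_mul_sectorGroundProj (A : Matrix n n ℂ) (K : Submodule ℂ (n → ℂ))
    {Q : Matrix n n ℂ} {q : ℂ} (hQ : ∀ v ∈ K, Q *ᵥ v = q • v) :
    (Q - q • (1 : Matrix n n ℂ)) * A.sectorGroundProj K = 0 := by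
  rw [sub_mul, mul_sectorGroundProj_of_scalar_on A K hQ, smul_mul_assoc, one_mul, sub_self]

/-- Sector ideal, left form: `P (Q − q·1) = 0` if `Q` is Hermitian, `q` real and `Q = q` on the
sector. [folklore] -/
theorem sectorGroundProj_mul_sub_smul (A : Matrix n n ℂ) (K : Submodule ℂ (n → ℂ))
    {Q : Matrix n n ℂ} (hQh : Q.IsHermitian) {q : ℝ} (hQ : ∀ v ∈ K, Q *ᵥ v = (q : ℂ) • v) :
    A.sectorGroundProj K * (Q - (q : ℂ) • (1 : Matrix n n ℂ)) = 0 := by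
  have h := congrArg conjTranspose (sub_smul_mul_sectorGroundProj A K hQ)
  rw [conjTranspose_mul, (sectorGroundProj_isHermitian A K).eq, conjTranspose_sub,
    conjTranspose_smul, conjTranspose_one, hQh.eq, conjTranspose_zero] at h
  simpa using h

/-- An operator commuting with `A` and preserving the sector maps the sector ground multiplet into
itself. [folklore] -/
theorem mulVec_mem_sectorGroundSpace {A U : Matrix n n ℂ} (K : Submodule ℂ (n → ℂ))
    (hU : U * A = A * U) (hUK : ∀ v ∈ K, U *ᵥ v ∈ K) {v : n → ℂ} (hv : v ∈ A.sectorGroundSpace K) :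
    U *ᵥ v ∈ A.sectorGroundSpace K := by
  rw [mem_sectorGroundSpace_iff] at hv ⊢
  refine ⟨hUK v hv.1, ?_⟩
  rw [mulVec_mulVec, ← hU, ← mulVec_mulVec, hv.2, mulVec_smul]

/-- `P U P = U P` for `U` commuting with `A` and preserving the sector. [folklore] -/
theorem sectorGroundProj_mul_mul_sectorGroundProj {A U : Matrix n n ℂ} (K : Submodule ℂ (n → ℂ))
    (hU : U * A = A * U) (hUK : ∀ v ∈ K, U *ᵥ v ∈ K) :
    A.sectorGroundProj K * U * A.sectorGroundProj K = U * A.sectorGroundProj K := by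
  rw [ext_iff_mulVec]
  intro v
  rw [← mulVec_mulVec, ← mulVec_mulVec, ← mulVec_mulVec]
  exact sectorGroundProj_mulVec_of_mem A K
    (mulVec_mem_sectorGroundSpace K hU hUK (sectorGroundProj_mulVec_mem A K v))

/-- **Symmetries commute with the sector ground projection**: if `U` commutes with the Hermitian
`A` and both `U` and `Uᴴ` preserve the sector, then `P U = U P`. Tasaki (2020) §2.1 (symmetry of
ground-state expectations). [cite: Tasaki2020, §2.1] -/
theorem sectorGroundProj_commute {A U : Matrix n n ℂ} (hA : A.IsHermitian) (K : Submodule ℂ (n → ℂ))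
    (hU : U * A = A * U) (hUK : ∀ v ∈ K, U *ᵥ v ∈ K) (hUK' : ∀ v ∈ K, Uᴴ *ᵥ v ∈ K) :
    A.sectorGroundProj K * U = U * A.sectorGroundProj K := by
  set P := A.sectorGroundProj K with hP
  have hPh : Pᴴ = P := (sectorGroundProj_isHermitian A K).eq
  have h1 : P * U * P = U * P := sectorGroundProj_mul_mul_sectorGroundProj K hU hUK
  have hU' : Uᴴ * A = A * Uᴴ := conjTranspose_commute_of_commute hA hU
  have h2 : P * Uᴴ * P = Uᴴ * P := sectorGroundProj_mul_mul_sectorGroundProj K hU' hUK'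
  have h3 := congrArg conjTranspose h2
  rw [conjTranspose_mul, conjTranspose_mul, conjTranspose_mul, conjTranspose_conjTranspose, hPh,
    ← mul_assoc] at h3
  -- `h3 : P * U * P = P * U`
  rw [← h3, h1]

/-! ### The tracial sector ground state and the symmetric certificate -/

/-- **The tracial sector ground state is a feasible point of the bootstrap and certifies the sector
energy.** For Hermitian `A`, an `A`-invariant sector `K ≠ ⊥`, and an identity
`A − c·1 = Σᵢⱼ Λᵢⱼ Oᵢᴴ Oⱼ + Σₖ (A Xₖ − Xₖ A) + Σₗ (Uₗ Yₗ Uₗᴴ − Yₗ) + Σᵣ (Zᵣ (Qᵣ − qᵣ) + (Qᵣ − qᵣ) Z'ᵣ)`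
with `Λ ⪰ 0`, symmetries `Uₗ` (commuting with `A`, `Uₗ`, `Uₗᴴ` preserving `K`, `Uₗᴴ Uₗ = 1`) and
Hermitian charges `Qᵣ` acting as the real scalar `qᵣ` on `K`: `c ≤ minEnergyOn A K`.
Han 2020 §2, eq. (2)–(3), all constraints (positivity, `⟨[H,O]⟩ = 0`, `⟨U⁻¹OU⟩ = ⟨O⟩`,
`⟨[C,O]⟩ = 0`) in dual form on a finite cluster. [cite: Han2020Bootstrap, §2 eq. (2)–(3)] -/
theorem minEnergyOn_ge_of_symmetric_certificate {A : Matrix n n ℂ} (hA : A.IsHermitian)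
    (K : Submodule ℂ (n → ℂ)) (hKA : ∀ v ∈ K, A *ᵥ v ∈ K) (hK : K ≠ ⊥)
    {m : Type*} [Fintype m] [DecidableEq m] {Λ : Matrix m m ℂ} (hΛ : Λ.PosSemidef)
    (O : m → Matrix n n ℂ)
    {κ : Type*} (s : Finset κ) (X : κ → Matrix n n ℂ)
    {ι : Type*} (t : Finset ι) (U Y : ι → Matrix n n ℂ) (hU : ∀ l ∈ t, U l * A = A * U l)
    (hUK : ∀ l ∈ t, ∀ v ∈ K, U l *ᵥ v ∈ K) (hUK' : ∀ l ∈ t, ∀ v ∈ K, (U l)ᴴ *ᵥ v ∈ K)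
    (hUU : ∀ l ∈ t, (U l)ᴴ * U l = 1)
    {ρ : Type*} (r : Finset ρ) (Q Z Z' : ρ → Matrix n n ℂ) (q : ρ → ℝ)
    (hQh : ∀ i ∈ r, (Q i).IsHermitian) (hQ : ∀ i ∈ r, ∀ v ∈ K, Q i *ᵥ v = ((q i : ℝ) : ℂ) • v)
    {c : ℝ}
    (hcert : A - (c : ℂ) • (1 : Matrix n n ℂ) =
      gramForm Λ O + (∑ k ∈ s, (A * X k - X k * A) + ∑ l ∈ t, (U l * Y l * (U l)ᴴ - Y l) +
        ∑ i ∈ r, (Z i * (Q i - ((q i : ℝ) : ℂ) • 1) + (Q i - ((q i : ℝ) : ℂ) • 1) * Z' i))) :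
    c ≤ A.minEnergyOn K := by
  set P := A.sectorGroundProj K with hP
  set e : ℂ := ((A.minEnergyOn K : ℝ) : ℂ) with he
  have hPh : P.IsHermitian := sectorGroundProj_isHermitian A K
  have hP2 : P * P = P := sectorGroundProj_mul_self A K
  have hP0 : P ≠ 0 := sectorGroundProj_ne_zero hA K hKA hK
  have hAP : A * P = e • P := mul_sectorGroundProj A K
  have hPA : P * A = e • P := sectorGroundProj_mul hA K
  set ω := P.projState with hω
  have hpos : ∀ a : Matrix n n ℂ, 0 ≤ ω (star a * a) := fun a => by
    rw [hω, star_eq_conjTranspose]; exact projState_nonneg hPh hP2 a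
  have hone : ω 1 = 1 := projState_one hPh hP2 hP0
  have hnull : ω (∑ k ∈ s, (A * X k - X k * A) + ∑ l ∈ t, (U l * Y l * (U l)ᴴ - Y l) +
      ∑ i ∈ r, (Z i * (Q i - ((q i : ℝ) : ℂ) • 1) + (Q i - ((q i : ℝ) : ℂ) • 1) * Z' i)) = 0 := by
    rw [map_add, map_add, map_sum, map_sum, map_sum]
    have h1 : ∀ k ∈ s, ω (A * X k - X k * A) = 0 := fun k _ => projState_commutator hAP hPA _
    have h2 : ∀ l ∈ t, ω (U l * Y l * (U l)ᴴ - Y l) = 0 := fun l hl => by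
      rw [map_sub, hω, projState_conj (sectorGroundProj_commute hA K (hU l hl) (hUK l hl) (hUK' l hl))
        (hUU l hl), sub_self]
    have h3 : ∀ i ∈ r, ω (Z i * (Q i - ((q i : ℝ) : ℂ) • 1) + (Q i - ((q i : ℝ) : ℂ) • 1) * Z' i) = 0 :=
      fun i hi => by
        rw [map_add, hω, projState_mul_of_mul_eq_zero (sub_smul_mul_sectorGroundProj A K (hQ i hi)),
          projState_mul_of_mul_eq_zero' (sectorGroundProj_mul_sub_smul A K (hQh i hi) (hQ i hi)),
          add_zero]
    rw [Finset.sum_eq_zero h1, Finset.sum_eq_zero h2, Finset.sum_eq_zero h3, add_zero, add_zero]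
  have h := le_re_map_of_certificate ω hpos hone hΛ O hnull hcert
  rwa [hω, projState_self hPh hP2 hP0 hPA, he, Complex.ofReal_re] at h

/-! ### A second conserved charge: joint eigenvectors and charged operators

For the number-and-spin conserving bootstrap (Han 2020 §2: `⟨O⟩ = 0` unless `O` commutes with every
conserved charge `C`; certificate format `certsdp/1` §3, `zero_charge_moments`) one needs a sector
ground vector that is ALSO an eigenvector of a further Hermitian charge `Q` (for Hubbard: `Q = S^z`
on the `N`-particle sector), and the rule that an operator of non-zero `Q`-charge,
`Q M − M Q = k M`, `k ≠ 0`, has vanishing expectation in every `Q`-eigenvector. -/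

omit [DecidableEq n] in
/-- Eigenvalues of a Hermitian matrix are real, in eigenvector form: `Q v = μ v`, `v ≠ 0` ⇒
`Q v = q v` for a real `q` (`= Re μ`). [folklore] -/
theorem IsHermitian.exists_real_mulVec_eq_smul {Q : Matrix n n ℂ} (hQ : Q.IsHermitian) {μ : ℂ}
    {v : n → ℂ} (hv : Q *ᵥ v = μ • v) (hv0 : v ≠ 0) : ∃ q : ℝ, Q *ᵥ v = (q : ℂ) • v := by
  have hs : star v ⬝ᵥ v ≠ 0 := fun h => hv0 (dotProduct_star_self_eq_zero.mp h)
  have h1 : star v ⬝ᵥ Q *ᵥ v = μ * (star v ⬝ᵥ v) := by rw [hv, dotProduct_smul, smul_eq_mul]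
  have h2 : star v ⬝ᵥ Q *ᵥ v = star μ * (star v ⬝ᵥ v) := by
    have h := star_mulVec Q v
    rw [hQ.eq, hv, star_smul] at h
    rw [dotProduct_mulVec, ← h, smul_dotProduct, smul_eq_mul]
  have hμ : star μ = μ := mul_right_cancel₀ hs (h2.symm.trans h1)
  refine ⟨μ.re, ?_⟩
  rw [hv, Complex.conj_eq_iff_re.mp hμ]

omit [DecidableEq n] in
/-- **Charged operators have zero expectation in a charge eigenvector**: for Hermitian `Q` with
`Q v = q v` and `Q M − M Q = k M` with `k ≠ 0` (an operator of `Q`-charge `k`), `⟨v, M v⟩ = 0`.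
Han 2020 §2 ("`⟨O⟩ = 0` unless `[C, O] = 0`"). [cite: Han2020Bootstrap, §2] -/
theorem star_dotProduct_mulVec_eq_zero_of_charge {Q M : Matrix n n ℂ} (hQ : Q.IsHermitian) {q : ℝ}
    {v : n → ℂ} (hv : Q *ᵥ v = (q : ℂ) • v) {k : ℂ} (hk : k ≠ 0) (hM : Q * M - M * Q = k • M) :
    star v ⬝ᵥ M *ᵥ v = 0 := by
  have h := vectorState_commutator hQ hv M
  rw [hM, map_smul, smul_eq_mul, vectorState_apply] at h
  exact (mul_eq_zero.mp h).resolve_left hk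

/-- Charges add along a word: if every letter `M a` has `Q`-charge `k a` (`Q M − M Q = k M`), the
word `(l.map M).prod` has charge `(l.map k).sum` (so a fermionic word has `S^z`-charge
Σ spins of creators − Σ spins of annihilators; two-factor case:
`Literature.MathematicalPhysics.QuantumLattice.comm_mul_of_comm_eq_smul`). [folklore] -/
theorem commutator_list_prod_of_charge {Q : Matrix n n ℂ} {α : Type*} (M : α → Matrix n n ℂ)
    (k : α → ℂ) (h : ∀ a, Q * M a - M a * Q = k a • M a) (l : List α) :
    Q * (l.map M).prod - (l.map M).prod * Q = (l.map k).sum • (l.map M).prod := by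
  induction l with
  | nil => simp
  | cons a l ih =>
    simp only [List.map_cons, List.prod_cons, List.sum_cons]
    have e : Q * (M a * (l.map M).prod) - M a * (l.map M).prod * Q =
        (Q * M a - M a * Q) * (l.map M).prod + M a * (Q * (l.map M).prod - (l.map M).prod * Q) := by
      simp only [sub_mul, mul_sub, ← mul_assoc]; abel
    rw [e, h a, ih, smul_mul_assoc, mul_smul_comm, add_smul]

/-- **Joint eigenvector in the sector ground multiplet.** For Hermitian `A`, an `A`-invariant sector
`K ≠ ⊥` and a Hermitian `Q` commuting with `A` and preserving `K`, there is a UNIT vector `v ∈ K`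
with `A v = (minEnergyOn A K) v` and `Q v = q v` for some real `q`: the sector ground multiplet
`sectorGroundSpace A K` is a non-trivial `Q`-invariant subspace, on which `Q` has an eigenvector.
(For Hubbard: `K` = `N`-particle sector, `Q = S^z`; this is why a certificate may drop monomials of
non-zero spin charge as well, `certsdp/1` §3.) Tasaki (2020) §2.2; Han 2020 §2.
[cite: Han2020Bootstrap, §2] -/
theorem exists_unit_joint_eigenvector_minEnergyOn {A Q : Matrix n n ℂ} (hA : A.IsHermitian)
    (K : Submodule ℂ (n → ℂ)) (hKA : ∀ v ∈ K, A *ᵥ v ∈ K) (hK : K ≠ ⊥) (hQ : Q.IsHermitian)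
    (hQA : Q * A = A * Q) (hQK : ∀ v ∈ K, Q *ᵥ v ∈ K) :
    ∃ v ∈ K, star v ⬝ᵥ v = 1 ∧ A *ᵥ v = ((A.minEnergyOn K : ℝ) : ℂ) • v ∧
      ∃ q : ℝ, Q *ᵥ v = (q : ℂ) • v := by
  have hS : A.sectorGroundSpace K ≠ ⊥ := inf_eigenspace_minEnergyOn_ne_bot hA K hKA hK
  haveI : Nontrivial (A.sectorGroundSpace K) := Submodule.nontrivial_iff_ne_bot.mpr hS
  have hinv : ∀ v ∈ A.sectorGroundSpace K, Matrix.toLin' Q v ∈ A.sectorGroundSpace K :=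
    fun v hv => by rw [Matrix.toLin'_apply]; exact mulVec_mem_sectorGroundSpace K hQA hQK hv
  obtain ⟨μ, hμ⟩ := Module.End.exists_eigenvalue ((Matrix.toLin' Q).restrict hinv)
  obtain ⟨w, hw⟩ := hμ.exists_hasEigenvector
  have hw0 : (w : n → ℂ) ≠ 0 := fun h => hw.2 (Submodule.coe_eq_zero.mp h)
  have hQw : Q *ᵥ (w : n → ℂ) = μ • (w : n → ℂ) := by
    have h := congrArg Subtype.val hw.apply_eq_smul
    rw [LinearMap.coe_restrict_apply, Matrix.toLin'_apply, Submodule.coe_smul] at h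
    exact h
  obtain ⟨hwK, hwA⟩ := (mem_sectorGroundSpace_iff A K _).mp w.2
  obtain ⟨c, -, -, hc1⟩ := EigenvalueContinuation.exists_normalize hw0
  obtain ⟨q, hq⟩ := hQ.exists_real_mulVec_eq_smul hQw hw0
  refine ⟨(c : ℂ) • (w : n → ℂ), K.smul_mem _ hwK, hc1, ?_, q, ?_⟩
  · rw [mulVec_smul, hwA, smul_comm]
  · rw [mulVec_smul, hq, smul_comm]

/-- **Bootstrap certificate with two conserved charges and a residual ⇒ sector ground energy.**
For Hermitian `A`, an `A`-invariant sector `K ≠ ⊥`, a Hermitian charge `Q` commuting with `A` and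
preserving `K`, and an identity
`A − c·1 = Σᵢⱼ Λᵢⱼ Oᵢᴴ Oⱼ + Σₖ (A Xₖ − Xₖ A) + Σₗ (Yₗ Zₗ + Z'ₗ Y'ₗ) + Σⱼ Nⱼ + r`
with `Λ ⪰ 0`, sector annihilators `Zₗ v = 0 = Z'ₗᴴ v` on `K`, `Q`-CHARGED operators
`Q Nⱼ − Nⱼ Q = kⱼ Nⱼ` (`kⱼ ≠ 0`), and a residual with `−ε ≤ Re ⟨v, r v⟩` on unit vectors of `K`
(e.g. `ε = Σ|coeff|` over contractions, `Matrix.IsContraction.neg_norm_mul_le`): then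
`c − ε ≤ minEnergyOn A K`. This is the soundness statement of a `certsdp/1` sector-mode certificate
with `zero_charge_moments` for both `N̂` (through `K`) and `S^z` (through `Q`). Han 2020 §2 eq. (2)–(3);
KSDN 2024 §5.3 for the residual. [cite: Han2020Bootstrap, §2 eq. (2)–(3)] -/
theorem minEnergyOn_ge_of_certificate_charged {A Q : Matrix n n ℂ} (hA : A.IsHermitian)
    (K : Submodule ℂ (n → ℂ)) (hKA : ∀ v ∈ K, A *ᵥ v ∈ K) (hK : K ≠ ⊥) (hQ : Q.IsHermitian)
    (hQA : Q * A = A * Q) (hQK : ∀ v ∈ K, Q *ᵥ v ∈ K)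
    {m : Type*} [Fintype m] [DecidableEq m] {Λ : Matrix m m ℂ} (hΛ : Λ.PosSemidef)
    (O : m → Matrix n n ℂ)
    {κ : Type*} (s : Finset κ) (X : κ → Matrix n n ℂ)
    {ι : Type*} (t : Finset ι) (Y Z Z' Y' : ι → Matrix n n ℂ)
    (hZ : ∀ l ∈ t, ∀ v ∈ K, Z l *ᵥ v = 0) (hZ' : ∀ l ∈ t, ∀ v ∈ K, (Z' l)ᴴ *ᵥ v = 0)
    {ρ : Type*} (u : Finset ρ) (Nc : ρ → Matrix n n ℂ) (k : ρ → ℂ) (hk : ∀ j ∈ u, k j ≠ 0)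
    (hNc : ∀ j ∈ u, Q * Nc j - Nc j * Q = k j • Nc j)
    {r : Matrix n n ℂ} {ε : ℝ}
    (hr : ∀ v ∈ K, star v ⬝ᵥ v = 1 → -ε ≤ (star v ⬝ᵥ r *ᵥ v).re) {c : ℝ}
    (hcert : A - (c : ℂ) • (1 : Matrix n n ℂ) =
      gramForm Λ O + (∑ k ∈ s, (A * X k - X k * A) + ∑ l ∈ t, (Y l * Z l + Z' l * Y' l) +
        ∑ j ∈ u, Nc j) + r) :
    c - ε ≤ A.minEnergyOn K := by
  obtain ⟨v, hvK, hv1, hAv, q, hQv⟩ :=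
    exists_unit_joint_eigenvector_minEnergyOn hA K hKA hK hQ hQA hQK
  set ω := vectorState v with hω
  have hpos : ∀ a : Matrix n n ℂ, 0 ≤ ω (star a * a) := fun a => vectorState_nonneg v a
  have hone : ω 1 = 1 := by rw [hω, vectorState_apply, one_mulVec, hv1]
  have hnull : ω (∑ k ∈ s, (A * X k - X k * A) + ∑ l ∈ t, (Y l * Z l + Z' l * Y' l) +
      ∑ j ∈ u, Nc j) = 0 := by
    rw [map_add, map_add, map_sum, map_sum, map_sum]
    have h1 : ∀ k ∈ s, ω (A * X k - X k * A) = 0 := fun k _ => vectorState_commutator hA hAv _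
    have h2 : ∀ l ∈ t, ω (Y l * Z l + Z' l * Y' l) = 0 := fun l hl => by
      rw [map_add, hω, vectorState_mul_of_mulVec_eq_zero v _ (hZ l hl v hvK),
        vectorState_mul_of_conjTranspose_mulVec_eq_zero v _ (hZ' l hl v hvK), add_zero]
    have h3 : ∀ j ∈ u, ω (Nc j) = 0 := fun j hj => by
      rw [hω, vectorState_apply]
      exact star_dotProduct_mulVec_eq_zero_of_charge hQ hQv (hk j hj) (hNc j hj)
    rw [Finset.sum_eq_zero h1, Finset.sum_eq_zero h2, Finset.sum_eq_zero h3, add_zero, add_zero]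
  have hr' : -ε ≤ (ω r).re := by rw [hω, vectorState_apply]; exact hr v hvK hv1
  have h := le_re_map_of_certificate_residual ω hpos hone hΛ O hnull hr' hcert
  rwa [hω, vectorState_apply, hAv, dotProduct_smul, hv1, smul_eq_mul, mul_one,
    Complex.ofReal_re] at h

end Matrix
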